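import Summits.CriticalPhenomena.PercolationContinuityZ3.Theorems.PercNearOneGluingNoHeavyPcintBSMRZ6RShort
import HarnessLib

/-!
# PCINT lane, PHASE 9 (block renewal with reach-3 pieces): kernel checks of the Green tables for `ℤ^6`

Cell `prim-pcint`, seat `prim-pcint-1` (gen 17); memo `run/shared/lean/prim/pcint/T-FIBRE-ROUTE.md` §PHASE 9.
Instance `Z6R`: `d = 6 = 4 + 2` (`k = 4` time axes, the transverse plane), bond percolation, reach-3 pieces,
7-point law `A/DA = [3, 20, 120, 714, 120, 20, 3]/1000`, horizon `N = 150` (window half-width `60`), Fourier tail (cut-off data,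
`θ₀ = 1/2`) `T = 123061401/10^12`, cell `p = 1452/10^4`. `GqN (termsLit …) δ · DG ≤ table δ · (DU · D^2)` on all sorted
offsets, from the literal short tables (the final rewrites them with `BSMR.termsFrom_eq_termsLit`).
-/

namespace Summit.CriticalPhenomena.PercolationContinuityZ3.Theorems.Pcint.BSMR.Z6R

open Summit.CriticalPhenomena.PercolationContinuityZ3.Theorems.Pcint.BSMR Summit.CriticalPhenomena.PercolationContinuityZ3.Theorems.Pcint.BSMX Summit.CriticalPhenomena.PercolationContinuityZ3.Theorems.Pcint.BSM

set_option maxHeartbeats 0 in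
set_option maxRecDepth 65536 in
/-- The diagonal Green table check (literal short tables; the law is restated to keep the statement instance-specific). -/
theorem hG0L : lawA = [3, 20, 120, 714, 120, 20, 3] ∧ ∀ δ ∈ CL218, GqN (termsLit BSMX.Z6.Ul 0 SH 150) 18 δ * 1000000000000 ≤ G0n δ * (1000000000000000 * 1000000000000000 ^ 2) := by
  refine ⟨rfl, ?_⟩
  decide +kernel

set_option maxHeartbeats 0 in
set_option maxRecDepth 65536 in
/-- The adjacent Green table check (literal short tables; law restated). -/
theorem hG1L : lawA = [3, 20, 120, 714, 120, 20, 3] ∧ ∀ δ ∈ CL218, GqN (termsLit BSMX.Z6.Cl 0 SH 150) 18 δ * 1000000000000 ≤ G1n δ * (1000000000000000 * 1000000000000000 ^ 2) := by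
  refine ⟨rfl, ?_⟩
  decide +kernel

end Summit.CriticalPhenomena.PercolationContinuityZ3.Theorems.Pcint.BSMR.Z6R
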